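import Summits.QuantumFields.BalabanUV.Beta.SymAveragingMixedJetWords
import Summits.QuantumFields.BalabanUV.Beta.RootedGaugeCovariance

/-!
# `BalabanUV.Beta.SymRootedGaugeCovariance` — binder row D1, TABLES-SYM step S2c (an1), module G1σ: **THE MOTHER IDENTITY FOR THE
# (0.4)-SYMMETRISED ROOTED AVERAGING** — group-level background-gauge covariance of S2b's `symPhiGAt ρ` (B7 (11) «Ū^u = (Ū)^u», rooted,
# over the `(σ,σ′)`-pair loop family), EXACTLY, over any ring

HONEST FRAMING (cell charter, verbatim): «discharging BetaPertH makes Balaban's UV stability UNCONDITIONAL — a real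
constructive-QFT result; it is NOT the continuum limit and NOT the Clay problem.»
HONEST DEPENDENCY: continuum YM on T⁴ ⇐ BetaPertH ∧ nine spine estimates (0/9 proved); BetaPertH ⇐ (D1) ∧ (D4) ∧ CAP+tail;
G-an2-4 gates asym, D1 and NE2/3/4.
DERIVED cell leaf ([folklore] telescoping along S2a's permuted comb letter lists + conjugation-equivariance of the truncated series, BY NAME
over node 12 `AveragingThirdJet` (`Tel`, `gaugeF`∕`gaugeB`, `tel_axial`, `tel_segUp`, `tel_rev_segUp`, `logT_conj`, `expT_conj`), the owner's
G1 `RootedGaugeCovariance` (`tel_cSegAt`) and S2b `SymAveragingMixedJetTables.symPhiGAt`).  This file is the `S_d × S_d` twin of the owner's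
G1 `RootedGaugeCovariance.PhiGAt_gauge`: the ONLY new ingredient is the transport of letters under an axis permutation (`permL σ`), which turns
the telescoping of node 5's comb (`tel_axial`) into the telescoping of S2a's comb of axis order `σ` (`tel_axialP`).  No statement of Bałaban's
papers is asserted (B7 (11) is an object LOCATOR only), no `[cite:]`, no `def … : Prop`.  First module of the sym twin of the owner's chain
(G1)–(G4) towards the (0.4) second-order Ward TABLE laws (T2-B)∕(T2-M₂) of `RowD1JointEndSymWardTablesAn1` (an1 step S2c); discharges NO letter
by itself.  NOT D1, NOT `BetaPertH`, NOT continuum, NOT Clay.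

WHAT (any ring `R` that is a `𝕜`-algebra, any pair of site functions `u`, `ub` with `u·ub = ub·u = 1` pointwise, any transporter pair `G`, `Ḡ`):
* §1 THE LETTER PERMUTATION `permL σ : δ_{(κ,x)} ↦ δ_{(σκ, σ•x)}` (pattern: node 12b's letter shift `shiftL`): `permL_δ`, `mapForm_permL_δ`
  (`mapForm (permL σ) δ = P1g σ δ`), TRANSPORT `holG_map_permL` (`hol_{G,Ḡ}(permL σ • l) = hol_{P1g σ G, P1g σ Ḡ}(l)`), S2a's permuted comb as
  an image `axialP_eq_map` (`axialP σ δ y x = (axial δ (σ⁻¹y) (σ⁻¹x)).map (permL σ)`), and the pull-back of a gauge transform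
  `P1g_gaugeF`∕`P1g_gaugeB` (`P1g σ (G^u) = (P1g σ G)^{u∘σ}`).
* §2 TELESCOPING along the permuted comb `tel_axialP` (both directions), along the pair word `tel_gammaPAt` (from the root `r = L·y + ρ` to
  `r + L·e_μ`) and around the closed pair loop `tel_loopPAt` (conjugation by `u(r)`).
* §3 **`symPhiGAt_gauge`**: `symPhiGAt 𝕜 ρ (gaugeF u ub G) (gaugeB u ub Ḡ) L μ y = u r · symPhiGAt 𝕜 ρ G Ḡ L μ y · ub (r + L·e_μ)` — EXACT, no
  smallness, no commutativity, no nilpotency; and `symPhiGAt_gauge_mul` (the far factor moved to the left).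
Provenance: β sub-cell, W-supplier `b2b-balaban-beta-an1` gen 43 (scratch for courier by the row-D1 owner), 2026-08-21 (v1); no existing
file touched.
-/

namespace Summit.QuantumFields.BalabanUV.Beta.SymRootedGaugeCovariance

open Finset
open scoped BigOperators Nat
open Literature.MathematicalPhysics.QuantumFieldTheory.Balaban1983to89.Beta
open Literature.MathematicalPhysics.QuantumFieldTheory.Balaban1983to89.Beta.AffineAveraging
open Literature.MathematicalPhysics.QuantumFieldTheory.Balaban1983to89.Beta.AveragingContours
open Literature.MathematicalPhysics.QuantumFieldTheory.Balaban1983to89.Beta.AveragingContoursRooted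
open Literature.MathematicalPhysics.QuantumFieldTheory.Balaban1983to89.Beta.TransportedContourVariables
open Literature.MathematicalPhysics.QuantumFieldTheory.Balaban1983to89.Beta.AveragingHessianKernels
open Literature.MathematicalPhysics.QuantumFieldTheory.Balaban1983to89.Beta.AveragingThirdJet
open Literature.MathematicalPhysics.QuantumFieldTheory.Balaban1983to89.Beta.AveragingMixedJetTables
open Summit.QuantumFields.BalabanUV.Beta.KernelPermutation (psite psite_apply psite_symm_apply psite_add)
open Summit.QuantumFields.BalabanUV.Beta.ResolventPermutation (psite_unitVec)
open Summit.QuantumFields.BalabanUV.Beta.SymAveragingHessianCounts (P1g P1g_apply axialP lettersIn_axialP gammaPAt loopPAt)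
open Summit.QuantumFields.BalabanUV.Beta.SymAveragingMixedJetTables (symPhiGAt)
open Summit.QuantumFields.BalabanUV.Beta.RootedGaugeCovariance (tel_cSegAt)

variable {𝕜 : Type*} [Field 𝕜] {d : ℕ} {R : Type*} [Ring R] [Algebra 𝕜 R]

/-! ## §1 The axis permutation acting on letters -/

section PermL

/-- [folklore] THE LETTER PERMUTATION by `σ`: the additive endomorphism `δ_{(κ,x)} ↦ δ_{(σ κ, σ•x)}` of the free letter group. -/
noncomputable def permL (σ : Equiv.Perm (Fin d)) : LetterGrp d →+ LetterGrp d :=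
  Finsupp.mapDomain.addMonoidHom fun p : Fin d × (Fin d → ℤ) => (σ p.1, psite σ p.2)

/-- [folklore] The letter permutation on a generator. -/
@[simp] theorem permL_δ (σ : Equiv.Perm (Fin d)) (κ : Fin d) (x : Fin d → ℤ) :
    permL σ (δ κ x : LetterGrp d) = δ (σ κ) (psite σ x) := by
  simp [permL, δ, Finsupp.mapDomain_single]

/-- [folklore] Pushing the universal one-form along the letter permutation is S2a's pull-back `P1g σ` of it. -/
theorem mapForm_permL_δ (σ : Equiv.Perm (Fin d)) : mapForm (permL σ) (δ : Form1 d (LetterGrp d)) = P1g σ δ := by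
  funext κ x
  simp only [mapForm_apply, permL_δ, P1g_apply]

/-- [folklore] S2a's comb of axis order `σ` IS the permuted image of node 5's comb between the pulled-back endpoints. -/
theorem axialP_eq_map (σ : Equiv.Perm (Fin d)) (y x : Fin d → ℤ) :
    axialP σ (δ : Form1 d (LetterGrp d)) y x = (axial δ ((psite σ).symm y) ((psite σ).symm x)).map (permL σ) := by
  rw [axial_map, mapForm_permL_δ]; rfl

omit [Algebra 𝕜 R] in
/-- [folklore] TRANSPORT UNDER THE LETTER PERMUTATION: the holonomy of a permuted letter list is the holonomy of the pulled-back
transporters along the original list. -/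
theorem holG_map_permL (G Gb : Form1 d R) (σ : Equiv.Perm (Fin d)) {P : (Fin d → ℤ) → Prop} {l : List (LetterGrp d)}
    (hl : LettersIn δ P l) : holG G Gb (l.map (permL σ)) = holG (P1g σ G) (P1g σ Gb) l := by
  induction l with
  | nil => simp
  | cons a l ih =>
    have hl' : LettersIn δ P l := fun b hb => hl b (by simp [hb])
    obtain ⟨κ, x, -, rfl | rfl⟩ := hl a (by simp)
    · rw [List.map_cons, holG_cons, holG_cons, ih hl', permL_δ, realize_delta, realize_delta]; rfl
    · rw [List.map_cons, holG_cons, holG_cons, ih hl', map_neg, permL_δ, realize_neg_delta, realize_neg_delta]; rfl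

omit [Algebra 𝕜 R] in
/-- [folklore] The pull-back of a gauge-transformed FORWARD transporter is the gauge transform (by `u ∘ σ`) of the pull-back. -/
theorem P1g_gaugeF (σ : Equiv.Perm (Fin d)) (u ub : (Fin d → ℤ) → R) (G : Form1 d R) :
    P1g σ (gaugeF u ub G) = gaugeF (fun x => u (psite σ x)) (fun x => ub (psite σ x)) (P1g σ G) := by
  funext κ z
  simp only [P1g_apply, gaugeF, psite_add, psite_unitVec]

omit [Algebra 𝕜 R] in
/-- [folklore] The pull-back of a gauge-transformed BACKWARD transporter is the gauge transform (by `u ∘ σ`) of the pull-back. -/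
theorem P1g_gaugeB (σ : Equiv.Perm (Fin d)) (u ub : (Fin d → ℤ) → R) (Gb : Form1 d R) :
    P1g σ (gaugeB u ub Gb) = gaugeB (fun x => u (psite σ x)) (fun x => ub (psite σ x)) (P1g σ Gb) := by
  funext κ z
  simp only [P1g_apply, gaugeB, psite_add, psite_unitVec]

end PermL

/-! ## §2 Telescoping along the permuted comb, the pair word and the pair loop -/

section Paths

variable {u ub : (Fin d → ℤ) → R} {G Gb : Form1 d R}

omit [Algebra 𝕜 R] in
/-- [folklore] A telescoping statement for the pulled-back data along `l` is a telescoping statement for the original data along the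
permuted list `permL σ • l`, between the permuted endpoints. -/
theorem tel_of_permL (σ : Equiv.Perm (Fin d)) {P : (Fin d → ℤ) → Prop} {l : List (LetterGrp d)} (hlP : LettersIn δ P l)
    {s e : Fin d → ℤ} (h : Tel (fun z => u (psite σ z)) (fun z => ub (psite σ z)) (P1g σ G) (P1g σ Gb) l s e) :
    Tel u ub G Gb (l.map (permL σ)) (psite σ s) (psite σ e) := by
  unfold Tel at h ⊢
  rw [holG_map_permL _ _ σ hlP, holG_map_permL _ _ σ hlP, P1g_gaugeF, P1g_gaugeB]
  simpa only using h

variable (hr : ∀ x, u x * ub x = 1) (hl : ∀ x, ub x * u x = 1)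
include hr hl

omit [Algebra 𝕜 R] in
/-- [folklore] TELESCOPING along S2a's comb of axis order `σ` from `y` to `x`, and along its reverse. -/
theorem tel_axialP (σ : Equiv.Perm (Fin d)) (y x : Fin d → ℤ) :
    Tel u ub G Gb (axialP σ δ y x) y x ∧ Tel u ub G Gb (rev (axialP σ δ y x)) x y := by
  obtain ⟨h₁, h₂⟩ := tel_axial (G := P1g σ G) (Gb := P1g σ Gb) (u := fun z => u (psite σ z)) (ub := fun z => ub (psite σ z))
    (fun z => hr _) (fun z => hl _) ((psite σ).symm y) ((psite σ).symm x)
  refine ⟨?_, ?_⟩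
  · have h := tel_of_permL σ (lettersIn_axial δ _ _) h₁
    rwa [Equiv.apply_symm_apply, Equiv.apply_symm_apply, ← axialP_eq_map] at h
  · have h := tel_of_permL σ (lettersIn_axial δ _ _).rev h₂
    rwa [Equiv.apply_symm_apply, Equiv.apply_symm_apply, rev_map, ← axialP_eq_map] at h

omit [Algebra 𝕜 R] in
/-- [folklore] TELESCOPING along the rooted pair word `γ^{σ,σ′,ρ}_x`: from the root `r = L·y + ρ` to `r + L·e_μ`. -/
theorem tel_gammaPAt (σ σ' : Equiv.Perm (Fin d)) (ρ : Fin d → ℤ) (L : ℕ) (μ : Fin d) (y : Fin d → ℤ) (b : Fin d → ℕ) :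
    Tel u ub G Gb (gammaPAt σ σ' ρ δ L μ y b) ((L : ℤ) • y + ρ) ((L : ℤ) • y + ρ + (L : ℤ) • unitVec μ) := by
  unfold gammaPAt
  exact Tel.append hl (Tel.append hl (tel_axialP hr hl σ _ _).1 (tel_segUp hr hl _ μ L))
    (tel_axialP hr hl σ' ((L : ℤ) • y + ρ + (L : ℤ) • unitVec μ) ((L : ℤ) • y + toSite b + (L : ℤ) • unitVec μ)).2

omit [Algebra 𝕜 R] in
/-- [folklore] TELESCOPING around the closed pair loop `γ^{σ,σ′,ρ}_x ∪ (−c)`: conjugation by `u(r)`. -/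
theorem tel_loopPAt (σ σ' : Equiv.Perm (Fin d)) (ρ : Fin d → ℤ) (L : ℕ) (μ : Fin d) (y : Fin d → ℤ) (b : Fin d → ℕ) :
    Tel u ub G Gb (loopPAt σ σ' ρ δ L μ y b) ((L : ℤ) • y + ρ) ((L : ℤ) • y + ρ) := by
  unfold loopPAt
  exact Tel.append hl (tel_gammaPAt hr hl σ σ' ρ L μ y b) (tel_rev_segUp hr hl _ μ L)

/-! ## §3 The rooted mother identity for the pair averaging -/

/-- [folklore] **THE ROOTED MOTHER IDENTITY, (0.4)-SYMMETRISED** (group-level background-gauge covariance of the pair averaging, B7 (11)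
«Ū^u = (Ū)^u» as an object locator; the `S_d × S_d` twin of `RootedGaugeCovariance.PhiGAt_gauge`):
`symΦ^ρ_b(G^u) = u(r) · symΦ^ρ_b(G) · u(r + L·e_μ)⁻¹`, `r = L·y + ρ`, EXACTLY — only telescoping around every pair loop (all closed at the root)
and the conjugation-equivariance of `logT`∕`expT`. -/
theorem symPhiGAt_gauge (ρ : Fin d → ℤ) (L : ℕ) (μ : Fin d) (y : Fin d → ℤ) :
    symPhiGAt 𝕜 ρ (gaugeF u ub G) (gaugeB u ub Gb) L μ y
      = u ((L : ℤ) • y + ρ) * symPhiGAt 𝕜 ρ G Gb L μ y * ub ((L : ℤ) • y + ρ + (L : ℤ) • unitVec μ) := by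
  have hloop : ∀ (b : Fin d → ℕ) (σ σ' : Equiv.Perm (Fin d)), holG (gaugeF u ub G) (gaugeB u ub Gb) (loopPAt σ σ' ρ δ L μ y b)
      = u ((L : ℤ) • y + ρ) * holG G Gb (loopPAt σ σ' ρ δ L μ y b) * ub ((L : ℤ) • y + ρ) :=
    fun b σ σ' => tel_loopPAt hr hl σ σ' ρ L μ y b
  have hc : holG (gaugeF u ub G) (gaugeB u ub Gb) (segUp δ ((L : ℤ) • y + ρ) μ L)
      = u ((L : ℤ) • y + ρ) * holG G Gb (segUp δ ((L : ℤ) • y + ρ) μ L) * ub ((L : ℤ) • y + ρ + (L : ℤ) • unitVec μ) :=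
    tel_cSegAt hr hl ρ L μ y
  simp only [symPhiGAt, hloop, hc, logT_conj (hr _) (hl _), ← Finset.sum_mul, ← Finset.mul_sum]
  rw [smul_conj, expT_conj (hr _) (hl _), tel_mul hl]

/-- [folklore] The same with the far gauge factor moved to the left: `symΦ^ρ_b(G^u) · u(r + L·e_μ) = u(r) · symΦ^ρ_b(G)`. -/
theorem symPhiGAt_gauge_mul (ρ : Fin d → ℤ) (L : ℕ) (μ : Fin d) (y : Fin d → ℤ) :
    symPhiGAt 𝕜 ρ (gaugeF u ub G) (gaugeB u ub Gb) L μ y * u ((L : ℤ) • y + ρ + (L : ℤ) • unitVec μ)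
      = u ((L : ℤ) • y + ρ) * symPhiGAt 𝕜 ρ G Gb L μ y := by
  rw [symPhiGAt_gauge hr hl, mul_assoc, hl, mul_one]

end Paths

end Summit.QuantumFields.BalabanUV.Beta.SymRootedGaugeCovariance
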